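import Summits.CriticalPhenomena.PercolationContinuityZ3.Theorems.Transplant.CayleySkeletonClassThree
import HarnessLib

/-!
# `θ(p_c) = 0` on LETTERS-ONLY Cayley graphs of nilpotent groups of class `≤ 3` with two sign automorphisms

builds on p205010 (kernel theorem, internal audit signed; external expert review pending).
Lane `prim-bschramm`, seat `prim-bschramm-p4` gen 11 (PART C3 of `P4-GENERAL.md`, "thick frames").  Helper file
(`--supports stmt-CriticalPhenomena-4575 --as helper`).

`NilTwoSigns.SignData` (file `CayleyNilTwoLetters`, gen 10) gave `θ_g(p) = 0`, `p ≤ p_c`, on the letters-only Cayley graph of every group of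
class `≤ 2` with a signed rank-2 letter quotient, through the corner-admissible kernel criterion.  This file replaces class `≤ 2` by CLASS `≤ 3`
(`γ₃(Γ) = 1`; weaker, so it subsumes the class-2 row): **`NilThreeSigns.SignData.theta_eq_zero_of_le`**.  Input: a finite symmetric generating
set `A` of `Γ`, an additive `φ : Γ → ℤ²` whose letters are kernel letters or `x^{±1}, y^{±1}` (`φx = e₀`, `φy = e₁`), automorphisms `ν, κ`
permuting `A` with `φν = −φ`, `φκ = diag(1,−1)φ`.  Route: `CylBase.boxWalks_of_classThree` (the unit cylinder `C_1` is connected) ⟹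
`CayleySign₂` (connected-cylinder criterion, thick frames give Φ2) ⟹ the D″ node.  No commutator letters, no central element, no growth input.
-/

noncomputable section

namespace Summit.CriticalPhenomena.PercolationContinuityZ3.Theorems.Transplant

namespace NilThreeSigns

open SimpleGraph Subgroup Literature.Probability.LatticeModels Literature.Probability.Percolation
open scoped commutatorElement Classical

/-- **The input: a group of class `≤ 3` with a signed rank-2 letter quotient (letters only).** [cite: KozmaNitzan2024, §4 p. 16 (Lemma 8)] -/
structure SignData (Γ : Type) [Group Γ] where
  /-- the letters -/
  A : Finset Γ
  /-- the letters are symmetric -/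
  symm : ∀ a ∈ A, a⁻¹ ∈ A
  /-- the letters generate -/
  gen : Subgroup.closure (A : Set Γ) = ⊤
  /-- class `≤ 3` -/
  nil : (⊤ : Subgroup Γ).lowerCentralSeries 3 = ⊥
  /-- the skeleton -/
  φ : Γ → Site 2
  /-- additivity -/
  map_mul : ∀ g h : Γ, φ (g * h) = φ g + φ h
  /-- the first distinguished letter -/
  x : Γ
  /-- it is a letter -/
  x_mem : x ∈ A
  /-- its height -/
  φ_x : φ x = Pi.single 0 1
  /-- the second distinguished letter -/
  y : Γ
  /-- it is a letter -/
  y_mem : y ∈ A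
  /-- its height -/
  φ_y : φ y = Pi.single 1 1
  /-- every letter is in the kernel or among `x^{±1}, y^{±1}` -/
  letters : ∀ a ∈ A, φ a = 0 ∨ a = x ∨ a = x⁻¹ ∨ a = y ∨ a = y⁻¹
  /-- the reversing automorphism -/
  ν : Γ ≃* Γ
  /-- `ν` permutes the letters -/
  ν_mem : ∀ a, ν a ∈ A ↔ a ∈ A
  /-- `φν = −φ` -/
  ν_φ : ∀ g, φ (ν g) = -φ g
  /-- the axis flip -/
  κ : Γ ≃* Γ
  /-- `κ` permutes the letters -/
  κ_mem : ∀ a, κ a ∈ A ↔ a ∈ A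
  /-- `φκ = diag(1,−1)φ` -/
  κ_φ : ∀ g, φ (κ g) = flipSnd (φ g)

namespace SignData

variable {Γ : Type} [Group Γ] (T : SignData Γ)

/-- `φ g⁻¹ = −φ g`. [folklore] -/
theorem φ_inv_eq₃ (g : Γ) : T.φ g⁻¹ = -T.φ g := KerGen.phi_inv T.φ T.map_mul g

/-- The letters have sup-norm `≤ 1`. [folklore] -/
theorem lip_A₃ (s : Γ) (hs : s ∈ T.A) (j : Fin 2) : |T.φ s j| ≤ 1 := by
  rcases T.letters s hs with h | rfl | rfl | rfl | rfl
  · rw [h]; simp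
  · rw [T.φ_x]; fin_cases j <;> simp
  · rw [T.φ_inv_eq₃, T.φ_x]; fin_cases j <;> simp
  · rw [T.φ_y]; fin_cases j <;> simp
  · rw [T.φ_inv_eq₃, T.φ_y]; fin_cases j <;> simp

/-- The base datum (skeleton and the two distinguished letters). [folklore] -/
def base : CayCyl.CylBase Γ T.A where
  φ := T.φ
  map_mul := T.map_mul
  lip := T.lip_A₃
  s₀ := T.x
  s₀_mem := T.x_mem
  φ_s₀ := T.φ_x
  s₁ := T.y
  s₁_mem := T.y_mem
  φ_s₁ := T.φ_y

/-- **Every kernel element is joined to `1` inside the unit cylinder** (class `≤ 3`, letters only). [folklore] -/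
theorem boxWalks₃ (k : Γ) (hk : T.φ k = 0) :
    ∃ w : (mulCayley (T.A : Set Γ)).Walk (1 : Γ) k, T.base.InBox 1 w :=
  T.base.boxWalks_of_classThree T.nil T.gen T.symm T.letters k hk

/-- **The `CayleySign₂` datum of a class-3 `SignData`** (connected unit cylinder from `boxWalks₃`). [folklore] -/
def cayleySign₂ : CayleySign₂ Γ T.A where
  φ := T.φ
  map_mul := T.map_mul
  lip := T.lip_A₃
  step := fun i => by
    fin_cases i
    · exact ⟨T.x, T.x_mem, T.φ_x⟩
    · exact ⟨T.y, T.y_mem, T.φ_y⟩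
  ν := T.ν
  ν_mem := T.ν_mem
  ν_φ := T.ν_φ
  cyl_one := (T.base.toCylData₂ 1 T.boxWalks₃).cylG_connected_of_boxWalks T.boxWalks₃ le_rfl
  κ := T.κ
  κ_mem := T.κ_mem
  κ_φ := T.κ_φ

include T in
/-- **THEOREM (letters only, class `≤ 3`, unconditional): `θ_g(p) = 0` for every `p ≤ p_c` at every vertex of `Cay(Γ; A)`** for every group of
nilpotency class `≤ 3` carrying a `SignData` — the Cayley graph of the LETTERS, no commutator generators added; two sign automorphisms; Φ2 by
thick frames; the class-2 row `NilTwoSigns.SignData.theta_eq_zero_of_le` is the special case `γ₂ = 1 ⊆ γ₃`.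
builds on p205010 (kernel theorem, internal audit signed; external expert review pending).
[cite: BenjaminiSchramm1996, Conj. 4] [cite: AizenmanGrimmett1991, Thm 1] [cite: KozmaNitzan2024, §1 p. 2 (approach 1)] -/
theorem theta_eq_zero_of_le (g : Γ) {p : unitInterval} (hp : (p : ℝ) ≤ criticalProb (mulCayley (T.A : Set Γ)) g) :
    theta (mulCayley (T.A : Set Γ)) g p = 0 :=
  T.cayleySign₂.theta_eq_zero_of_le g hp

include T in
/-- **`θ_g(p_c) = 0` at every vertex of `Cay(Γ; A)`** (the `p = p_c` case).
builds on p205010 (kernel theorem, internal audit signed; external expert review pending). [cite: BenjaminiSchramm1996, Conj. 4] -/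
theorem criticalContinuity (g : Γ) :
    theta (mulCayley (T.A : Set Γ)) g (criticalProbIOf (mulCayley (T.A : Set Γ)) g) = 0 :=
  T.theta_eq_zero_of_le g le_rfl

/-- A class-`≤ 2` group is class `≤ 3`: the datum of file `CayleyNilTwoLetters` is a special case. [folklore] -/
theorem lcs_three_eq_bot_of_two (h : (⊤ : Subgroup Γ).lowerCentralSeries 2 = ⊥) : (⊤ : Subgroup Γ).lowerCentralSeries 3 = ⊥ :=
  le_bot_iff.1 ((Subgroup.lowerCentralSeries_antitone (⊤ : Subgroup Γ) (by norm_num : 2 ≤ 3)).trans (le_of_eq h))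

end SignData

end NilThreeSigns

end Summit.CriticalPhenomena.PercolationContinuityZ3.Theorems.Transplant

end
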